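import Literature.MathematicalPhysics.QuantumFieldTheory.Balaban1983to89.B1Eq239Normalization

/-!
# `Balaban1983to89.B1Eq221GaussStep` — T. Bałaban, *(Higgs)₂,₃ quantum fields in a finite volume. I. A lower bound*, Commun. Math. Phys. **85** (1982) 603–626 [Balaban1982Higgs1]: «and calculating the integral in (2.19), we obtain (2.21)» — the renormalization transformation (2.4)–(2.6)/(2.10) APPLIED TO A CENTRED GAUSSIAN DENSITY, (2.18)/(2.19), COMPUTED on the tree's carriers: `(Tρ)(ψ) = (Tρ)(0)·exp(−½⟨ψ,Δψ⟩)` with `⟨ψ,Δψ⟩` the Schur complement of the joint exponent (completing the square (3.10)–(3.11) + translation invariance of `dφ`)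

statement-level skeleton of published theorems with citation tags; proofs where landed; nothing here is a claim about the Yang–Mills mass gap

PDF held: `paper:balaban1982-cmp85-higgs23-i` (journal page = PDF page + 602); p. 610 [PDF 8], p. 614 [PDF 12] and
p. 617 [PDF 15] read AS IMAGES from the ×2 renders
`run/shared/lean/pub/pub-balaban/b2b-balaban-ref1/pages/1982-cmp85-higgs23-I/1982-cmp85-higgs23-I-p008-x2.png`,
`…-p012-x2.png`, `…-p015-x2.png` of the cell `pub-balaban`.

CITATION HEADER (lean-in-tree rule) — WHAT IS REPRODUCED.  Cell `lit-balaban`, Phase-2 proof seat p34 (gen 3), free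
target of SKELETON rows **B1.Eq2.17** (`(2.17)–(2.19)`: «typed … the Gaussian integral defining Z^{(k)} not typed»)
and **B1.Eq2.21** (`proved-existing (algebra)`: `B1RG242.StepData.Δk` DEFINES Δ^{(k)} by the right-hand side of
(2.21)); owner r14 (`lit-balaban-r14/LOCALIDS-r14.md` row B1-2.21: «Gaussian integral quoted»).  p. 610, verbatim:
*"We define inductively  Δ^{(0),ε}(Ω,A) = −Δ^{ε,N}_{A,Ω} + m², (2.17)
Z^{(k),L^kε}(Ω,A) exp(−½⟨ψ,Δ^{(k+1),L^{k+1}ε}(Ω,A)ψ⟩) = T^{L^kε}_{a,L,A}[Ω^{(k)}, exp(−½⟨φ,Δ^{(k),L^kε}(Ω,A)φ⟩)]. (2.18)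
From (2.16) we have  Z^ε_k(Ω,A) exp(−½⟨ψ,Δ^{(k),L^kε}(Ω,A)ψ⟩) = T^ε_{a_k,L^k,A}[Ω, exp(−½⟨φ,(−Δ^{ε,N}_{A,Ω}+m²)φ⟩)].
(2.19)  Defining the propagator  G^ε_k(Ω,A) = (−Δ^{ε,N}_{A,Ω} + m² + a_k(L^kε)^{−2}P_k(A))^{−1}, P_k(A) = Q^*_k(A)Q_k(A),
(2.20)  and calculating the integral in (2.19), we obtain
⟨ψ,Δ^{(k),L^kε}(Ω,A)ψ⟩ = a_k(L^kε)^{−2}⟨ψ,ψ⟩ − a_k²(L^kε)^{−4}⟨ψ,Q_k(A)G^ε_k(Ω,A)Q^*_k(A)ψ⟩. (2.21)"*;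
the transformation it refers to, pp. 608–609 (typed by r14 in `B1RT`): *"ρ′(A,ψ) = T^{L^kε}_{a,L,A}[Ω,ρ] =
∫dφ t^{L^kε}_{a,L,A}(Ω;ψ,φ)ρ(A,φ), (2.4)  t^{L^kε}_{a,L,A}(Ω;ψ,φ) = Π_{y∈Ω′} t^{L^kε}_{a,L,A}(ψ(y), φ↾_{B(y)}), (2.5)
t^{L^kε}_{a,L,A}(ψ(y),φ↾_{B(y)}) = (a(L^{k+1}ε)^{d−2}/2π)^{N/2} exp(−½a(L^{k+1}ε)^{d−2}|ψ(y) − (Q(A)φ)(y)|²) (2.6)"*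
(and (2.10): the same with a_k(L^kε)^{d−2}, Q_k(A)); the printed method, p. 614: *"The next step is the translation
in the fields A  A = A′ + aL^{−2}C^{(0)}Q^*B =: A′ + B^{(1)} (3.10)  separating the quadratic form in the fields A, B
in (3.7) into a sum of two forms … = ½⟨B,Δ^{(1),L}B⟩ + ½⟨A′,(C^{(0)})^{−1}A′⟩. (3.11)"*; p. 617: *"A^{(k),ε} =
a_k(L^kε)^{−2}G^ε_kQ^*_kA, φ^{(k),ε} = a_k(L^kε)^{−2}G^ε_k(A^{(k),ε})Q^*_k(A^{(k),ε})φ. (3.29)"* (the translated = minimising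
configurations), and (3.31)–(3.32) (the normalisation factors `Z_k`, `Z_k(A^{(k),ε})` = `Z^ε_k` of (2.19) in closed form).

WHY THIS FILE (what the tree said was missing, verbatim from the module headers it closes): `B1RG242` — *"NOT
CERTIFIED HERE … (i) The Gaussian-integral ↦ Schur-complement dictionary that turns (2.18)/(2.19) into the operator
definitions of §B ("calculating the integral in (2.19), we obtain (2.21)") … [folklore: finite-dimensional Gaussian
integration]; it is the REASON the defined objects are Bałaban's, and it is not re-derived from measure theory here"*;
`B1Eq239Normalization` (seat p15) — *"(ii) (2.21) itself ("calculating the integral in (2.19)") is not re-derived: §1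
needs only the VALUE AT 0 of the Gaussians (2.18)/(2.19) (= 1), never their quadratic forms"*; `B1Eq314Proof` (p14) —
*"the Gaussian-integral reading of (2.18) (why `β·1 − β²·QC^{(k)}Q*` IS Δ^{(k+1)}) stays the folklore dictionary"*;
`B1RG242Torus` likewise.  THIS MODULE does the measure theory ON r14's CARRIERS (`B1RT.rtOp` (2.4), `B1RT.blockKernel`
(2.5)–(2.6)/(2.10), block fields `ψ : Y → V`, fine fields `φ : X → V`, `V` ↤ R^N any finite-dimensional real inner
product space, `volume` = the product Lebesgue measure of p. 605); the companion `B1Eq221Dictionary` (same seat) does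
it in integration coordinates and identifies the resulting form with `B1RG242.StepData.Δk` (2.21) and the constant with
p15's `B1Eq239Normalization.zConst` ((3.31)/(3.32)).

DICTIONARY (print ↦ Lean).  `κ` ↤ the kernel constant `a_k(L^kε)^{d−2}` of (2.10) (resp. `a(L^{k+1}ε)^{d−2}` of (2.6));
`q : (X → V) →ₗ[ℝ] (Y → V)` ↤ the block average `Q_k(A)` (2.11) (resp. `Q(A)` (2.7)) AS A LINEAR MAP (r14's `B1.blockAvg` /
`B1RTSemigroup.qAvg` shapes are linear in φ; the transports U(A(Γ)) are inside `q`); `B : (X → V) →ₗ[ℝ] (X → V) →ₗ[ℝ] ℝ`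
↤ the SYMMETRIC bilinear form `⟨φ,Hφ′⟩_ε` of the density's exponent (H = −Δ^{ε,N}_{A,Ω} + m² in (2.19), H = Δ^{(k),L^kε}
with ⟨·,·⟩_{L^kε} in (2.18)); `gaussDensity B` ↤ `exp(−½⟨φ,Hφ⟩)`; `jointExp κ q B ψ φ` ↤ TWICE the full exponent of
`t(ψ,φ)·ρ(φ)`: `κΣ_y|ψ(y) − (Q_kφ)(y)|² + ⟨φ,Hφ⟩` (the (3.7)/(3.11) quadratic form in (φ, ψ), up to the factor ½);
`jointA κ q B` ↤ its φφ-part, the bilinear form of `H + κQ^*_kQ_k = (G^ε_k)^{−1}` (2.20) (scalar-product weights absorbed: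
see `B1Eq221Dictionary` for the weighted reading `a_k(L^kε)^{d−2}|·|² = a_k(L^kε)^{−2}⟨·,·⟩_{L^kε}`); `source κ q ψ` ↤ the
φψ-cross term `κΣ_y ψ(y)·(Q_kφ)(y) = ⟨κQ^*_kψ, φ⟩`; `IsStationary κ q B ψ φ₀` ↤ the Euler–Lagrange equation
`(H + κQ^*_kQ_k)φ₀ = κQ^*_kψ` of the exponent, i.e. `φ₀ = a_k(L^kε)^{−2}G^ε_kQ^*_kψ` = the translation (3.10) / the
configuration `φ^{(k),ε}` of (3.29); `schurForm κ q ψ φ₀` ↤ `⟨ψ,Δ^{(k)}ψ⟩` of (2.21) in the form the integral delivers it: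
`κ|ψ|² − ⟨κQ^*_kψ, φ₀⟩ = a_k(L^kε)^{−2}⟨ψ,ψ⟩ − a_k²(L^kε)^{−4}⟨ψ,Q_kG^ε_kQ^*_kψ⟩`; `kernelConst V κ Y` ↤ the prefactor
`((κ/2π)^{N/2})^{|Ω′|}` of (2.5)–(2.6).

WHAT IS KERNEL-CHECKED (0 sorry; axioms ⊆ {propext, Classical.choice, Quot.sound}).
 §1 the algebra of p. 614: at a stationary `φ₀`, `jointExp(φ₀) = schurForm` (`jointExp_eq_schurForm`) and COMPLETING
    THE SQUARE `jointExp(φ₀ + χ) = jointA(χ,χ) + schurForm` (`jointExp_add_of_isStationary`, = (3.11) with A′ ↤ χ,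
    B^{(1)} ↤ φ₀); the minimum property `schurForm ≤ jointExp(φ)` when `jointA ≥ 0` (`schurForm_le_jointExp`);
    existence and uniqueness of the stationary point for `jointA` positive definite, on the finite-dimensional
    carrier (`exists_isStationary` — injective ⇒ surjective into the dual — and `isStationary_unique`); `ψ = 0 ⇒ φ₀ = 0,
    schurForm = 0` (`isStationary_zero`, `schurForm_zero`, `jointExp_zero`).
 §2 the integral: `t(ψ,φ)·ρ(φ) = kernelConst·exp(−½·jointExp)` (`blockKernel_mul_gaussDensity`, the product (2.5) of the
    site kernels (2.6)/(2.10) collected into one exponential), and **`rtOp_gaussDensity_eq_of_isStationary`**: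
    `(Tρ)(ψ) = (Tρ)(0) · exp(−½·schurForm κ q ψ φ₀)` for EVERY symmetric `B`, every `κ`, every linear `q` and every
    stationary `φ₀` — by the translation `φ = φ₀ + χ` under the integral (Mathlib `integral_add_left_eq_self` for the
    product Lebesgue measure on `X → V`, an additive Haar measure) and §1; NO integrability or positivity hypothesis is
    needed for this identity (both sides are junk together when the Gaussian diverges).  Existential packaging under
    positivity `rtOp_gaussDensity_eq`; and, in p15's vocabulary ((2.18)/(2.19) READ as "Z := (Tρ)(0), the Gaussian :=
    Tρ/Z"), **`normShape_gaussDensity`**: `B1Eq239Normalization.normShape (blockKernel κ q) (gaussDensity B) ψ =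
    exp(−½·schurForm κ q ψ φ₀)` whenever `normConst ≠ 0` — i.e. the density that (2.18)/(2.19) DEFINE as
    `exp(−½⟨ψ,Δψ⟩)` IS a centred Gaussian, with the form (2.21).
HONEST SCOPE.  (i) This module identifies `⟨ψ,Δ^{(k)}ψ⟩` intrinsically (value of the joint exponent at its stationary
point); the identification with the MATRIX `B1RG242.StepData.Δk` and of `(Tρ)(0)` with the closed form (3.31)/(3.32) =
`B1Eq239Normalization.zConst` is done in integration coordinates in `B1Eq221Dictionary` (incl. the measure-free half of
the coordinate dictionary for the forms); the measure-preserving coordinates `(X → V) ≃ (X × Fin N → ℝ)` themselves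
(p15's item (i) for the constants) are not constructed here.  (ii) `q` is a HYPOTHESIS-FREE linear map and `B` any
symmetric bilinear form: Bałaban's concrete `Q_k(A)` (2.11) and `−Δ^{ε,N}_{A,Ω} + m²` are not constructed in this module
(they are r14's / the typer's carriers; any linear instance may be substituted).  (iii) Nothing quantitative (Props.
2.1–2.3) is touched.  Value = the kernel certificate that the renormalization transformation maps centred Gaussians to
centred Gaussians with the Schur-complement form, on the carriers of record; NOT summit progress.
-/

open scoped BigOperators InnerProductSpace
open _root_.MeasureTheory _root_.Real

namespace Literature.MathematicalPhysics.QuantumFieldTheory.Balaban1983to89.B1Eq221GaussStep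

open B1RT

/-! ## §1  The joint exponent of `t(ψ,φ)·exp(−½⟨φ,Hφ⟩)` and its stationary point (pp. 610, 614, 617) -/

section Algebra

variable {V : Type*} [NormedAddCommGroup V] [InnerProductSpace ℝ V]
variable {X Y : Type*} [Fintype Y]

/-- The centred Gaussian density `exp(−½⟨φ,Hφ⟩)` to which the transformation is applied in (2.18)/(2.19), `B φ φ′` ↤
`⟨φ,Hφ′⟩` (H = −Δ^{ε,N}_{A,Ω} + m² in (2.19); H = Δ^{(k),L^kε} in (2.18)). [cite: Balaban1982Higgs1, (2.18)–(2.19) p.610] -/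
noncomputable def gaussDensity (B : (X → V) →ₗ[ℝ] (X → V) →ₗ[ℝ] ℝ) (φ : X → V) : ℝ :=
  Real.exp (-(1 / 2 : ℝ) * B φ φ)

/-- Twice the full exponent of the integrand `t(ψ,φ)ρ(φ)` of (2.19) (kernel (2.5)/(2.10) times density):
`κ Σ_y |ψ(y) − (Q_kφ)(y)|² + ⟨φ,Hφ⟩` — the quadratic form "in the fields A, B in (3.7)" of p. 614, with φ ↤ A, ψ ↤ B.
[cite: Balaban1982Higgs1, (2.10) p.609, (2.19) p.610, (3.7)/(3.11) pp.613–614] -/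
noncomputable def jointExp (κ : ℝ) (q : (X → V) →ₗ[ℝ] (Y → V)) (B : (X → V) →ₗ[ℝ] (X → V) →ₗ[ℝ] ℝ)
    (ψ : Y → V) (φ : X → V) : ℝ :=
  κ * ∑ y, ‖ψ y - q φ y‖ ^ 2 + B φ φ

/-- The φφ-part of the joint exponent as a bilinear expression: `κ Σ_y (Q_kφ)(y)·(Q_kχ)(y) + ⟨φ,Hχ⟩` = the form of
`H + κQ^*_kQ_k = (G^ε_k)^{−1}` (2.20) (`= ⟨A′,(C^{(0)})^{−1}A′⟩`-type member of (3.11)).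
[cite: Balaban1982Higgs1, (2.20) p.610, (3.11) p.614] -/
noncomputable def jointA (κ : ℝ) (q : (X → V) →ₗ[ℝ] (Y → V)) (B : (X → V) →ₗ[ℝ] (X → V) →ₗ[ℝ] ℝ)
    (φ χ : X → V) : ℝ :=
  κ * ∑ y, ⟪q φ y, q χ y⟫_ℝ + B φ χ

/-- The φψ-cross term of the joint exponent: `κ Σ_y ψ(y)·(Q_kχ)(y) = ⟨κQ^*_kψ, χ⟩`.
[cite: Balaban1982Higgs1, (2.19) p.610, (3.7) p.613] -/
noncomputable def source (κ : ℝ) (q : (X → V) →ₗ[ℝ] (Y → V)) (ψ : Y → V) (χ : X → V) : ℝ :=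
  κ * ∑ y, ⟪ψ y, q χ y⟫_ℝ

/-- `φ₀` is a STATIONARY POINT of the joint exponent at block field `ψ`: the Euler–Lagrange equation
`(H + κQ^*_kQ_k)φ₀ = κQ^*_kψ` in weak form, i.e. `φ₀ = κG^ε_kQ^*_kψ = a_k(L^kε)^{−2}G^ε_kQ^*_kψ` — the translation
`B^{(1)} = aL^{−2}C^{(0)}Q^*B` of (3.10) at k = 0 and the configuration `φ^{(k),ε}` of (3.29) in general.
[cite: Balaban1982Higgs1, (3.10) p.614, (3.29) p.617] -/
def IsStationary (κ : ℝ) (q : (X → V) →ₗ[ℝ] (Y → V)) (B : (X → V) →ₗ[ℝ] (X → V) →ₗ[ℝ] ℝ)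
    (ψ : Y → V) (φ₀ : X → V) : Prop :=
  ∀ χ, jointA κ q B φ₀ χ = source κ q ψ χ

/-- The value of the joint exponent at its stationary point, in the form the integration delivers it:
`κ|ψ|² − ⟨κQ^*_kψ, φ₀⟩`; with `φ₀ = κG^ε_kQ^*_kψ` this is `κ⟨ψ,ψ⟩ − κ²⟨ψ,Q_kG^ε_kQ^*_kψ⟩`, the right-hand side of
(2.21) (κ ↤ a_k(L^kε)^{−2} once the scalar-product weights (1.5) are restored, see `B1Eq221Dictionary`).
[cite: Balaban1982Higgs1, (2.21) p.610] -/
noncomputable def schurForm (κ : ℝ) (q : (X → V) →ₗ[ℝ] (Y → V)) (ψ : Y → V) (φ₀ : X → V) : ℝ :=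
  κ * ∑ y, ‖ψ y‖ ^ 2 - source κ q ψ φ₀

/-- `|a − (b + c)|² = |a − b|² − 2a·c + 2b·c + |c|²` (one block site). [folklore] -/
private theorem site_expand (a b c : V) :
    ‖a - (b + c)‖ ^ 2 = ‖a - b‖ ^ 2 - 2 * ⟪a, c⟫_ℝ + 2 * ⟪b, c⟫_ℝ + ‖c‖ ^ 2 := by
  rw [show a - (b + c) = (a - b) - c by abel, norm_sub_sq_real, inner_sub_left]
  ring

/-- `|a − b|² = |a|² − 2a·b + b·b` (one block site). [folklore] -/
private theorem site_expand₀ (a b : V) : ‖a - b‖ ^ 2 = ‖a‖ ^ 2 - 2 * ⟪a, b⟫_ℝ + ⟪b, b⟫_ℝ := by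
  rw [norm_sub_sq_real, real_inner_self_eq_norm_sq]

/-- `Σ_y|ψ(y) − θ(y)|² = Σ|ψ|² − 2Σψ·θ + Σθ·θ`. [folklore] -/
private theorem sum_norm_sub_sq (ψ : Y → V) (θ : Y → V) :
    ∑ y, ‖ψ y - θ y‖ ^ 2 = ∑ y, ‖ψ y‖ ^ 2 - 2 * ∑ y, ⟪ψ y, θ y⟫_ℝ + ∑ y, ⟪θ y, θ y⟫_ℝ := by
  simp only [site_expand₀, Finset.sum_add_distrib, Finset.sum_sub_distrib, Finset.mul_sum]

/-- `Σ_y|ψ(y) − (θ(y) + ξ(y))|² = Σ|ψ − θ|² − 2Σψ·ξ + 2Σθ·ξ + Σ|ξ|²`. [folklore] -/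
private theorem sum_norm_sub_add_sq (ψ θ ξ : Y → V) :
    ∑ y, ‖ψ y - (θ y + ξ y)‖ ^ 2
      = ∑ y, ‖ψ y - θ y‖ ^ 2 - 2 * ∑ y, ⟪ψ y, ξ y⟫_ℝ + 2 * ∑ y, ⟪θ y, ξ y⟫_ℝ + ∑ y, ‖ξ y‖ ^ 2 := by
  simp only [site_expand, Finset.sum_add_distrib, Finset.sum_sub_distrib, Finset.mul_sum]

/-- **The value at the stationary point**: `jointExp(ψ, φ₀) = κ|ψ|² − ⟨κQ^*_kψ, φ₀⟩ = ⟨ψ,Δ^{(k)}ψ⟩` (the first form of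
(3.11), `½⟨B,Δ^{(1),L}B⟩`, is this at k = 0). [cite: Balaban1982Higgs1, (2.21) p.610, (3.11) p.614] -/
theorem jointExp_eq_schurForm {κ : ℝ} {q : (X → V) →ₗ[ℝ] (Y → V)}
    {B : (X → V) →ₗ[ℝ] (X → V) →ₗ[ℝ] ℝ} {ψ : Y → V} {φ₀ : X → V} (hst : IsStationary κ q B ψ φ₀) :
    jointExp κ q B ψ φ₀ = schurForm κ q ψ φ₀ := by
  have h0 := hst φ₀
  unfold jointA source at h0
  unfold jointExp schurForm source
  rw [sum_norm_sub_sq]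
  linear_combination h0

/-- **COMPLETING THE SQUARE, (3.10)–(3.11) p. 614**: after the translation `φ = φ₀ + χ` by a stationary point the joint
exponent «separat[es] … into a sum of two forms» — the form of `(G^ε_k)^{−1} = H + κQ^*_kQ_k` in the fluctuation `χ`
(↤ `⟨A′,(C^{(0)})^{−1}A′⟩`) plus `⟨ψ,Δ^{(k)}ψ⟩` (↤ `⟨B,Δ^{(1),L}B⟩`); `B` symmetric.  (The tree's `B1Eq314Proof.split311_*`
prove the same display over abstract scalar products / `StepData` matrices; here it is on the `X → V` carriers of
`B1RT`.) [cite: Balaban1982Higgs1, (3.10)–(3.11) p.614] -/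
theorem jointExp_add_of_isStationary {κ : ℝ} {q : (X → V) →ₗ[ℝ] (Y → V)}
    {B : (X → V) →ₗ[ℝ] (X → V) →ₗ[ℝ] ℝ} (hB : ∀ φ χ, B φ χ = B χ φ) {ψ : Y → V} {φ₀ : X → V}
    (hst : IsStationary κ q B ψ φ₀) (χ : X → V) :
    jointExp κ q B ψ (φ₀ + χ) = jointA κ q B χ χ + schurForm κ q ψ φ₀ := by
  rw [← jointExp_eq_schurForm hst]
  have h1 := hst χ
  unfold jointA source at h1
  unfold jointExp jointA
  have hq : ∀ y, q (φ₀ + χ) y = q φ₀ y + q χ y := fun y => by rw [map_add]; rfl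
  simp only [hq, sum_norm_sub_add_sq, map_add, LinearMap.add_apply, hB χ φ₀]
  simp only [real_inner_self_eq_norm_sq]
  linear_combination (2 : ℝ) * h1

/-- At `ψ = 0` the joint exponent is the φφ-form alone: `jointExp(0, χ) = jointA(χ, χ)` (so `(Tρ)(0)`, p15's `normConst`,
is the integral of `kernelConst·exp(−½·jointA(χ,χ))` — (2.18)/(2.19) read at ψ = 0, cf. (3.31)/(3.32)).
[cite: Balaban1982Higgs1, (2.19) p.610, (3.31)–(3.32) p.617] -/
theorem jointExp_zero {κ : ℝ} {q : (X → V) →ₗ[ℝ] (Y → V)} {B : (X → V) →ₗ[ℝ] (X → V) →ₗ[ℝ] ℝ}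
    (χ : X → V) : jointExp κ q B 0 χ = jointA κ q B χ χ := by
  unfold jointExp jointA
  simp only [Pi.zero_apply, zero_sub, norm_neg, real_inner_self_eq_norm_sq]

/-- `φ₀ = 0` is stationary for `ψ = 0`. [cite: Balaban1982Higgs1, (3.29) p.617] -/
theorem isStationary_zero (κ : ℝ) (q : (X → V) →ₗ[ℝ] (Y → V)) (B : (X → V) →ₗ[ℝ] (X → V) →ₗ[ℝ] ℝ) :
    IsStationary κ q B 0 0 := by
  intro χ
  unfold jointA source
  simp only [map_zero, LinearMap.zero_apply, Pi.zero_apply, inner_zero_left, Finset.sum_const_zero,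
    mul_zero, add_zero]

/-- `⟨0,Δ0⟩ = 0`. [cite: Balaban1982Higgs1, (2.21) p.610] -/
theorem schurForm_zero (κ : ℝ) (q : (X → V) →ₗ[ℝ] (Y → V)) : schurForm κ q 0 (0 : X → V) = 0 := by
  unfold schurForm source
  simp

/-- **The stationary point MINIMISES the joint exponent** when the φφ-form is non-negative: `⟨ψ,Δ^{(k)}ψ⟩ ≤
jointExp(ψ, φ)` for every φ («the translation … separating the quadratic form … into a sum of two forms», the first
of which is non-negative). [cite: Balaban1982Higgs1, (3.10)–(3.11) p.614] -/
theorem schurForm_le_jointExp {κ : ℝ} {q : (X → V) →ₗ[ℝ] (Y → V)}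
    {B : (X → V) →ₗ[ℝ] (X → V) →ₗ[ℝ] ℝ} (hB : ∀ φ χ, B φ χ = B χ φ)
    (hnonneg : ∀ χ, 0 ≤ jointA κ q B χ χ) {ψ : Y → V} {φ₀ : X → V}
    (hst : IsStationary κ q B ψ φ₀) (φ : X → V) :
    schurForm κ q ψ φ₀ ≤ jointExp κ q B ψ φ := by
  have h := jointExp_add_of_isStationary hB hst (φ - φ₀)
  rw [add_sub_cancel] at h
  rw [h]
  linarith [hnonneg (φ - φ₀)]

/-- The φφ-form `jointA` as a bilinear map `(X → V) →ₗ (X → V) →ₗ ℝ` (the operator `H + κQ^*_kQ_k = (G^ε_k)^{−1}` of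
(2.20) in weak form). [cite: Balaban1982Higgs1, (2.20) p.610] -/
noncomputable def jointALin (κ : ℝ) (q : (X → V) →ₗ[ℝ] (Y → V)) (B : (X → V) →ₗ[ℝ] (X → V) →ₗ[ℝ] ℝ) :
    (X → V) →ₗ[ℝ] (X → V) →ₗ[ℝ] ℝ :=
  LinearMap.mk₂ ℝ (jointA κ q B)
    (fun m₁ m₂ n => by
      unfold jointA
      have hq : ∀ y, q (m₁ + m₂) y = q m₁ y + q m₂ y := fun y => by rw [map_add]; rfl
      simp only [hq, inner_add_left, Finset.sum_add_distrib, map_add, LinearMap.add_apply]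
      ring)
    (fun c m n => by
      unfold jointA
      have hq : ∀ y, q (c • m) y = c • q m y := fun y => by rw [map_smul]; rfl
      simp only [hq, real_inner_smul_left, ← Finset.mul_sum, map_smul, LinearMap.smul_apply, smul_eq_mul]
      ring)
    (fun m n₁ n₂ => by
      unfold jointA
      have hq : ∀ y, q (n₁ + n₂) y = q n₁ y + q n₂ y := fun y => by rw [map_add]; rfl
      simp only [hq, inner_add_right, Finset.sum_add_distrib, map_add]
      ring)
    (fun c m n => by
      unfold jointA
      have hq : ∀ y, q (c • n) y = c • q n y := fun y => by rw [map_smul]; rfl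
      simp only [hq, real_inner_smul_right, ← Finset.mul_sum, map_smul, smul_eq_mul]
      ring)

/-- Unfolding lemma (definitional). [cite: Balaban1982Higgs1, (2.20) p.610] -/
theorem jointALin_apply (κ : ℝ) (q : (X → V) →ₗ[ℝ] (Y → V)) (B : (X → V) →ₗ[ℝ] (X → V) →ₗ[ℝ] ℝ)
    (φ χ : X → V) : jointALin κ q B φ χ = jointA κ q B φ χ := rfl

/-- The cross term `⟨κQ^*_kψ, ·⟩` as a linear functional on the fine fields. [cite: Balaban1982Higgs1, (2.19) p.610] -/
noncomputable def sourceLin (κ : ℝ) (q : (X → V) →ₗ[ℝ] (Y → V)) (ψ : Y → V) : (X → V) →ₗ[ℝ] ℝ where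
  toFun := source κ q ψ
  map_add' m n := by
    unfold source
    have hq : ∀ y, q (m + n) y = q m y + q n y := fun y => by rw [map_add]; rfl
    simp only [hq, inner_add_right, Finset.sum_add_distrib]
    ring
  map_smul' c m := by
    unfold source
    have hq : ∀ y, q (c • m) y = c • q m y := fun y => by rw [map_smul]; rfl
    simp only [hq, real_inner_smul_right, ← Finset.mul_sum, RingHom.id_apply, smul_eq_mul]
    ring

/-- Unfolding lemma (definitional). [cite: Balaban1982Higgs1, (2.19) p.610] -/
theorem sourceLin_apply (κ : ℝ) (q : (X → V) →ₗ[ℝ] (Y → V)) (ψ : Y → V) (χ : X → V) :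
    sourceLin κ q ψ χ = source κ q ψ χ := rfl

/-- **Uniqueness of the stationary point** when the form of `(G^ε_k)^{−1} = H + κQ^*_kQ_k` is positive definite (e.g.
m² > 0, cf. `B1RG242.isUnit_of_posDef`): the translation (3.10)/(3.29) is well defined. [cite: Balaban1982Higgs1, (2.20) p.610, (3.29) p.617] -/
theorem isStationary_unique {κ : ℝ} {q : (X → V) →ₗ[ℝ] (Y → V)} {B : (X → V) →ₗ[ℝ] (X → V) →ₗ[ℝ] ℝ}
    (hpos : ∀ φ, φ ≠ 0 → 0 < jointA κ q B φ φ) {ψ : Y → V} {φ₀ φ₁ : X → V}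
    (h0 : IsStationary κ q B ψ φ₀) (h1 : IsStationary κ q B ψ φ₁) : φ₀ = φ₁ := by
  by_contra hne
  have hne' : φ₀ - φ₁ ≠ 0 := sub_ne_zero.mpr hne
  have hp := hpos _ hne'
  have hz : jointA κ q B (φ₀ - φ₁) (φ₀ - φ₁) = 0 := by
    rw [← jointALin_apply, LinearMap.map_sub₂, jointALin_apply, jointALin_apply, h0, h1, sub_self]
  exact (lt_irrefl (0 : ℝ)) (hz ▸ hp)

section Exists

variable [FiniteDimensional ℝ V] [Fintype X]

/-- **Existence of the stationary point** on the finite-dimensional carrier when the form of `(G^ε_k)^{−1}` is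
positive definite: the weak Euler–Lagrange map `φ ↦ jointA(φ, ·)` into the dual is injective, hence surjective
(equal finite dimensions), so `⟨κQ^*_kψ, ·⟩` is attained — the finite-lattice content of "Defining the propagator
G^ε_k = (…)^{−1} (2.20)". [cite: Balaban1982Higgs1, (2.20) p.610, (3.29) p.617] -/
theorem exists_isStationary {κ : ℝ} {q : (X → V) →ₗ[ℝ] (Y → V)} {B : (X → V) →ₗ[ℝ] (X → V) →ₗ[ℝ] ℝ}
    (hpos : ∀ φ, φ ≠ 0 → 0 < jointA κ q B φ φ) (ψ : Y → V) : ∃ φ₀, IsStationary κ q B ψ φ₀ := by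
  have hinj : Function.Injective (jointALin κ q B) := by
    intro φ φ' h
    by_contra hne
    have hne' : φ - φ' ≠ 0 := sub_ne_zero.mpr hne
    have hp := hpos _ hne'
    have hz : jointA κ q B (φ - φ') (φ - φ') = 0 := by
      rw [← jointALin_apply, LinearMap.map_sub₂, h, sub_self]
    exact (lt_irrefl (0 : ℝ)) (hz ▸ hp)
  have hsurj : Function.Surjective (jointALin κ q B) :=
    (LinearMap.injective_iff_surjective_of_finrank_eq_finrank (Subspace.dual_finrank_eq).symm).1 hinj
  obtain ⟨φ₀, h⟩ := hsurj (sourceLin κ q ψ)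
  exact ⟨φ₀, fun χ => by rw [← jointALin_apply, h, sourceLin_apply]⟩

end Exists

end Algebra

/-! ## §2  «calculating the integral in (2.19)»: `(Tρ)(ψ) = (Tρ)(0)·exp(−½⟨ψ,Δψ⟩)` on the carriers of `B1RT` -/

section Integral

variable {V : Type*} [NormedAddCommGroup V] [InnerProductSpace ℝ V] [FiniteDimensional ℝ V]
  [MeasurableSpace V] [BorelSpace V]
variable {X Y : Type*} [Fintype X] [Fintype Y]

variable (V) in
/-- The prefactor `((κ/2π)^{N/2})^{|Ω′|}` of the block kernel (2.5)–(2.6)/(2.10) (N = dim V, one factor per block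
site). [cite: Balaban1982Higgs1, (2.5)–(2.6) p.608, (2.10) p.609] -/
noncomputable def kernelConst (κ : ℝ) (Y : Type*) [Fintype Y] : ℝ :=
  ((κ / (2 * π)) ^ ((Module.finrank ℝ V : ℝ) / 2)) ^ Fintype.card Y

omit [FiniteDimensional ℝ V] [MeasurableSpace V] [BorelSpace V] [Fintype X] in
/-- The integrand of (2.19) collected into ONE exponential: `t(ψ,φ)·exp(−½⟨φ,Hφ⟩) = ((κ/2π)^{N/2})^{|Ω′|} ·
exp(−½·jointExp(ψ,φ))` (the product (2.5) of the site Gaussians (2.10)). [cite: Balaban1982Higgs1, (2.5) p.608, (2.10) p.609, (2.19) p.610] -/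
theorem blockKernel_mul_gaussDensity (κ : ℝ) (q : (X → V) →ₗ[ℝ] (Y → V))
    (B : (X → V) →ₗ[ℝ] (X → V) →ₗ[ℝ] ℝ) (ψ : Y → V) (φ : X → V) :
    blockKernel κ q ψ φ * gaussDensity B φ
      = kernelConst V κ Y * Real.exp (-(1 / 2 : ℝ) * jointExp κ q B ψ φ) := by
  unfold blockKernel rtKernel gaussDensity jointExp kernelConst
  rw [Finset.prod_mul_distrib, Finset.prod_const, Finset.card_univ, ← Real.exp_sum, mul_assoc,
    ← Real.exp_add]
  congr 2
  rw [mul_add, ← mul_assoc, Finset.mul_sum]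
  congr 1
  exact Finset.sum_congr rfl fun y _ => by ring

/-- **(2.18)/(2.19) COMPUTED — «calculating the integral in (2.19), we obtain (2.21)»**: for the transformation
`T = B1RT.rtOp (blockKernel κ q)` ((2.4)–(2.6)/(2.10)) applied to the centred Gaussian density `exp(−½⟨φ,Hφ⟩)`
(`B` ↤ `⟨·,H·⟩` symmetric) and ANY stationary point `φ₀` of the joint exponent at `ψ` (`φ₀ = a_k(L^kε)^{−2}G^ε_kQ^*_kψ`,
(3.29)):  `(Tρ)(ψ) = (Tρ)(0) · exp(−½⟨ψ,Δ^{(k)}ψ⟩)`, `⟨ψ,Δ^{(k)}ψ⟩ = schurForm κ q ψ φ₀ = κ|ψ|² − ⟨κQ^*_kψ, φ₀⟩` (2.21),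
`(Tρ)(0) = Z^ε_k` ((2.19) at ψ = 0, = (3.31)/(3.32)).  Proof = the printed one: the translation (3.10) `φ = φ₀ + χ` under
`∫dφ` (translation invariance of the product Lebesgue measure on `X → V`) and (3.11) (`jointExp_add_of_isStationary`).
No integrability/positivity hypothesis: both sides are the same junk value if the Gaussian diverges.
[cite: Balaban1982Higgs1, (2.18)–(2.21) p.610, (3.10)–(3.11) p.614] -/
theorem rtOp_gaussDensity_eq_of_isStationary {κ : ℝ} {q : (X → V) →ₗ[ℝ] (Y → V)}
    {B : (X → V) →ₗ[ℝ] (X → V) →ₗ[ℝ] ℝ} (hB : ∀ φ χ, B φ χ = B χ φ) {ψ : Y → V} {φ₀ : X → V}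
    (hst : IsStationary κ q B ψ φ₀) :
    rtOp (blockKernel κ q) (gaussDensity B) ψ
      = rtOp (blockKernel κ q) (gaussDensity B) 0 * Real.exp (-(1 / 2 : ℝ) * schurForm κ q ψ φ₀) := by
  simp only [rtOp_eq, blockKernel_mul_gaussDensity]
  have hL : ∫ φ : X → V, kernelConst V κ Y * Real.exp (-(1 / 2 : ℝ) * jointExp κ q B ψ φ)
      = ∫ χ : X → V, kernelConst V κ Y * Real.exp (-(1 / 2 : ℝ) * jointExp κ q B ψ (φ₀ + χ)) :=
    (integral_add_left_eq_self
      (fun φ => kernelConst V κ Y * Real.exp (-(1 / 2 : ℝ) * jointExp κ q B ψ φ)) φ₀).symm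
  rw [hL]
  simp only [jointExp_add_of_isStationary hB hst, jointExp_zero]
  have hpt : ∀ χ : X → V,
      kernelConst V κ Y * Real.exp (-(1 / 2 : ℝ) * (jointA κ q B χ χ + schurForm κ q ψ φ₀))
        = kernelConst V κ Y * Real.exp (-(1 / 2 : ℝ) * jointA κ q B χ χ)
            * Real.exp (-(1 / 2 : ℝ) * schurForm κ q ψ φ₀) := by
    intro χ
    rw [mul_add, Real.exp_add, mul_assoc]
  simp_rw [hpt]
  exact integral_mul_const _ _

/-- **(2.18)/(2.19) COMPUTED, existential packaging**: if the form of `(G^ε_k)^{−1} = H + κQ^*_kQ_k` is positive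
definite (B symmetric), the stationary point exists (`exists_isStationary`; unique by `isStationary_unique`) and
`(Tρ)(ψ) = (Tρ)(0)·exp(−½⟨ψ,Δ^{(k)}ψ⟩)`. [cite: Balaban1982Higgs1, (2.18)–(2.21) p.610] -/
theorem rtOp_gaussDensity_eq {κ : ℝ} {q : (X → V) →ₗ[ℝ] (Y → V)}
    {B : (X → V) →ₗ[ℝ] (X → V) →ₗ[ℝ] ℝ} (hB : ∀ φ χ, B φ χ = B χ φ)
    (hpos : ∀ φ, φ ≠ 0 → 0 < jointA κ q B φ φ) (ψ : Y → V) :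
    ∃ φ₀ : X → V, IsStationary κ q B ψ φ₀ ∧
      rtOp (blockKernel κ q) (gaussDensity B) ψ
        = rtOp (blockKernel κ q) (gaussDensity B) 0 * Real.exp (-(1 / 2 : ℝ) * schurForm κ q ψ φ₀) := by
  obtain ⟨φ₀, h⟩ := exists_isStationary hpos ψ
  exact ⟨φ₀, h, rtOp_gaussDensity_eq_of_isStationary hB h⟩

open B1Eq239Normalization in
/-- **(2.18)/(2.19) in the reading of `B1Eq239Normalization` (p15)**: with `Z := (Tρ)(0)` (`normConst`, the only thing
p15's §1 used) NON-ZERO, the normalised transformed density `normShape = Tρ/Z` — which (2.18) resp. (2.19) DEFINE to be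
`exp(−½⟨ψ,Δ^{(k+1)}ψ⟩)` resp. `exp(−½⟨ψ,Δ^{(k)}ψ⟩)` («We define inductively») — IS the centred Gaussian
`exp(−½·schurForm κ q ψ φ₀)`; its quadratic form is therefore COMPUTED, not posited: this is the measure-theoretic
content of «calculating the integral in (2.19), we obtain (2.21)» that p15's header item (ii) left open.
[cite: Balaban1982Higgs1, (2.18)–(2.21) p.610] -/
theorem normShape_gaussDensity {κ : ℝ} {q : (X → V) →ₗ[ℝ] (Y → V)}
    {B : (X → V) →ₗ[ℝ] (X → V) →ₗ[ℝ] ℝ} (hB : ∀ φ χ, B φ χ = B χ φ) {ψ : Y → V} {φ₀ : X → V}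
    (hst : IsStationary κ q B ψ φ₀) (hZ : normConst (blockKernel κ q) (gaussDensity B) ≠ 0) :
    normShape (blockKernel κ q) (gaussDensity B) ψ = Real.exp (-(1 / 2 : ℝ) * schurForm κ q ψ φ₀) := by
  unfold normShape
  rw [normConst_eq] at hZ ⊢
  rw [rtOp_gaussDensity_eq_of_isStationary hB hst, mul_div_cancel_left₀ _ hZ]

end Integral

end Literature.MathematicalPhysics.QuantumFieldTheory.Balaban1983to89.B1Eq221GaussStep
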